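import Literature.AlgebraicGeometry.Motives.MixedHodgeStructureLoewyLengthSubadditive
import HarnessLib

/-!
# The Loewy length of a graded-polarizable MHS is at most the number of its weights

For a graded-polarizable mixed Hodge structure `H` the tree proves `ℓ(H) ≤ b - a + 1` when `W_{a-1} H = 0`,
`W_b H = H` (`IsGradedPolarizable.loewyLength_le`, after Jannsen's argument, *Mixed Motives*, Thm. 7.9 (proof):
each pure graded-polarizable piece is semisimple). This file sharpens the bound to the number of **weights** of
`H` — the `k` with `Gr^W_k H ≠ 0`, i.e. `W_{k-1} H < W_k H` (the tree's `IsWeight`):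

* §1 `IsWeight` bookkeeping: `isWeight_iff_ne`, the weights of the sub-MHS `W_j H` are the weights `≤ j` of `H`
  (`isWeight_weight_iff`, `isWeight_of_isWeight_weight`), no weights outside `[a, b]`, and **the set of weights is
  finite** (`finite_setOf_isWeight`).
* §2 **`IsGradedPolarizable.loewyLength_le_card_filter_isWeight`**: `ℓ(H) ≤ #{k ∈ [a, b] | k is a weight}`,
  by induction on `b - a` through the extension `0 → W_{b-1} H → H → Gr^W_b H → 0` and subadditivity
  `ℓ(H) ≤ ℓ(H / W_{b-1}) + ℓ(W_{b-1})` (`SubMixedHodgeStructure.loewyLength_le_add`), with `ℓ(Gr^W_b H) ≤ 1`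
  (a polarizable pure Hodge structure is semisimple) and `= 0` when `b` is not a weight; the index-free form
  **`IsGradedPolarizable.loewyLength_le_ncard_isWeight`** `ℓ(H) ≤ #{weights of H}`, the comparison with the old
  bound, and the cases of at most one / two (not necessarily adjacent) weights.

Namespace `MixedHodgeStructure`; everything proved, no named facts.

## References

* [Jannsen1990MixedMotives] U. Jannsen, Mixed Motives and Algebraic K-Theory, LNM 1400 (1990), Thm. 7.9 (proof).
* [CattaniElZeinGriffithsLe2014] E. Cattani et al. (eds.), Hodge Theory (2014), Thm. 3.2.18, Lemma 3.2.20, p. 270.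
-/

noncomputable section

namespace Literature.AlgebraicGeometry.Motives

namespace MixedHodgeStructure

universe u

variable {V : Type u} [AddCommGroup V] [Module ℚ V]
variable {H : MixedHodgeStructure V}

open Module

/-! ### §1 Weights: `W_{k-1} < W_k` -/

variable (H) in
/-- `k` is a weight of `H` iff `W_{k-1} H ≠ W_k H`. [cite: CattaniElZeinGriffithsLe2014, Thm. 3.2.18] -/
theorem isWeight_iff_ne (k : ℤ) : H.IsWeight k ↔ H.W (k - 1) ≠ H.W k :=
  (H.monotone_W (show k - 1 ≤ k by omega)).lt_iff_ne

/-- No weight `k ≤ a` if `W_a H = 0`. [cite: CattaniElZeinGriffithsLe2014, Thm. 3.2.18] -/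
theorem not_isWeight_of_W_eq_bot {a k : ℤ} (ha : H.W a = ⊥) (hka : k ≤ a) : ¬H.IsWeight k := fun hk => by
  have hle : H.W k ≤ ⊥ := by rw [← ha]; exact H.monotone_W hka
  exact not_lt_bot (hk.trans_le hle)

/-- No weight `k > b` if `W_b H = H`. [cite: CattaniElZeinGriffithsLe2014, Thm. 3.2.18] -/
theorem not_isWeight_of_W_eq_top {b k : ℤ} (hb : H.W b = ⊤) (hbk : b < k) : ¬H.IsWeight k := fun hk => by
  have hle : ⊤ ≤ H.W (k - 1) := by rw [← hb]; exact H.monotone_W (show b ≤ k - 1 by omega)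
  exact not_top_lt (hle.trans_lt hk)

/-- The weights of `H` lie in `[a, b]` when `W_{a-1} H = 0` and `W_b H = H`. [cite: CattaniElZeinGriffithsLe2014, Thm. 3.2.18] -/
theorem IsWeight.mem_Icc {a b k : ℤ} (ha : H.W (a - 1) = ⊥) (hb : H.W b = ⊤) (hk : H.IsWeight k) :
    k ∈ Finset.Icc a b := by
  rw [Finset.mem_Icc]
  constructor
  · by_contra h
    exact not_isWeight_of_W_eq_bot ha (show k ≤ a - 1 by omega) hk
  · by_contra h
    exact not_isWeight_of_W_eq_top hb (show b < k by omega) hk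

variable (H) in
/-- **The set of weights of a mixed Hodge structure is finite.** [cite: CattaniElZeinGriffithsLe2014, Thm. 3.2.18] -/
theorem finite_setOf_isWeight : {k | H.IsWeight k}.Finite := by
  obtain ⟨a, ha⟩ := H.exists_W_eq_bot
  obtain ⟨b, hb⟩ := H.exists_W_eq_top
  refine (Finset.Icc (a + 1) b).finite_toSet.subset fun k hk => ?_
  exact Finset.mem_coe.2 (IsWeight.mem_Icc (by rw [add_sub_cancel_right]; exact ha) hb hk)

namespace SubMixedHodgeStructure

variable (H) in
/-- The weight filtration of the sub-MHS `W_j H`: `W_k(W_j H) = W_k H ∩ W_j H` (by `rfl`).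
[cite: CattaniElZeinGriffithsLe2014, Lemma 3.2.20] -/
theorem weight_toMixedHodgeStructure_W (j k : ℤ) :
    (weight H j).toMixedHodgeStructure.W k = (H.W k).comap (H.W j).subtype := rfl

variable (H) in
/-- For `k ≤ j`: **`k` is a weight of `W_j H` iff it is a weight of `H`.** [cite: CattaniElZeinGriffithsLe2014, Lemma 3.2.20] -/
theorem isWeight_weight_iff {j k : ℤ} (hkj : k ≤ j) : (weight H j).toMixedHodgeStructure.IsWeight k ↔ H.IsWeight k := by
  rw [isWeight_iff_ne, isWeight_iff_ne, weight_toMixedHodgeStructure_W, weight_toMixedHodgeStructure_W, not_iff_not]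
  constructor
  · intro h
    have h' := congrArg (Submodule.map (H.W j).subtype) h
    rwa [Submodule.map_comap_subtype, Submodule.map_comap_subtype,
      inf_eq_right.2 (H.monotone_W (show k - 1 ≤ j by omega)), inf_eq_right.2 (H.monotone_W hkj)] at h'
  · intro h
    rw [h]

variable (H) in
/-- `W_j H` has no weights `k > j`. [cite: CattaniElZeinGriffithsLe2014, Lemma 3.2.20] -/
theorem not_isWeight_weight_of_lt {j k : ℤ} (hjk : j < k) : ¬(weight H j).toMixedHodgeStructure.IsWeight k :=
  not_isWeight_of_W_eq_top (weight_toMixedHodgeStructure_W_of_le H le_rfl) hjk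

variable (H) in
/-- A weight of the sub-MHS `W_j H` is a weight of `H`. [cite: CattaniElZeinGriffithsLe2014, Lemma 3.2.20] -/
theorem isWeight_of_isWeight_weight {j k : ℤ} (h : (weight H j).toMixedHodgeStructure.IsWeight k) : H.IsWeight k := by
  rcases le_or_gt k j with hkj | hjk
  · exact (isWeight_weight_iff H hkj).1 h
  · exact absurd h (not_isWeight_weight_of_lt H hjk)

end SubMixedHodgeStructure

open SubMixedHodgeStructure

/-! ### §2 `ℓ(H) ≤` the number of weights -/

section Bound

open scoped Classical in
/-- `ℓ(H / W_{b-1} H) ≤ 1`, and `= 0` unless `b` is a weight (`W_b H = H`, `H` graded-polarizable): the quotient is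
the semisimple `Gr^W_b H`. [cite: Jannsen1990MixedMotives, Thm. 7.9 (proof)] -/
theorem IsGradedPolarizable.loewyLength_weight_quotient_le [FiniteDimensional ℚ V] (hp : H.IsGradedPolarizable)
    {b : ℤ} (hb : H.W b = ⊤) :
    loewyLength (weight H (b - 1)).quotient ≤ if H.IsWeight b then 1 else 0 := by
  split_ifs with hw
  · exact (hp.isSemisimple_weight_quotient hb).loewyLength_le_one
  · rw [Nat.le_zero, loewyLength_eq_zero_iff]
    have htop : H.W (b - 1) = ⊤ := by
      rw [IsWeight, hb, lt_top_iff_ne_top, not_not] at hw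
      exact hw
    exact Submodule.Quotient.subsingleton_iff.2 htop

open scoped Classical in
/-- The induction: `W_b G = G`, `W_{b-n} G = 0` ⇒ `ℓ(G) ≤ #{k ∈ (b - n, b] | k is a weight of G}`.
[cite: Jannsen1990MixedMotives, Thm. 7.9 (proof)] -/
private theorem loewyLength_le_card_aux (n : ℕ) : ∀ {W' : Type u} [AddCommGroup W'] [Module ℚ W']
    [FiniteDimensional ℚ W'] (G : MixedHodgeStructure W'), G.IsGradedPolarizable → ∀ b : ℤ, G.W b = ⊤ →
    G.W (b - n) = ⊥ → loewyLength G ≤ ((Finset.Ioc (b - n) b).filter G.IsWeight).card := by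
  induction n with
  | zero =>
    intro W' _ _ _ G _ b hb hbot
    rw [Nat.cast_zero, sub_zero, hb] at hbot
    haveI : Subsingleton W' := (Submodule.subsingleton_iff ℚ).1 (subsingleton_of_bot_eq_top hbot.symm)
    rw [loewyLength_eq_zero_iff.2 this]
    exact Nat.zero_le _
  | succ n ih =>
    intro W' _ _ _ G hp b hb hbot
    let S := weight G (b - 1)
    have h1 : loewyLength G ≤ loewyLength S.quotient + loewyLength S.toMixedHodgeStructure := S.loewyLength_le_add
    have h2 : loewyLength S.quotient ≤ if G.IsWeight b then 1 else 0 := hp.loewyLength_weight_quotient_le hb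
    have h3 : S.toMixedHodgeStructure.IsGradedPolarizable := hp.of_injective S.subtype (Submodule.injective_subtype _)
    have h4 : S.toMixedHodgeStructure.W (b - 1) = ⊤ := weight_toMixedHodgeStructure_W_of_le G le_rfl
    have h5 : S.toMixedHodgeStructure.W (b - 1 - n) = ⊥ := by
      rw [weight_toMixedHodgeStructure_W, show (b - 1 - (n : ℤ)) = b - ((n + 1 : ℕ) : ℤ) by push_cast; ring, hbot,
        Submodule.comap_bot, Submodule.ker_subtype]
      rfl
    have h6 := ih S.toMixedHodgeStructure h3 (b - 1) h4 h5
    have h7 : ((Finset.Ioc (b - 1 - n) (b - 1)).filter S.toMixedHodgeStructure.IsWeight).card ≤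
        ((Finset.Ioc (b - 1 - n) (b - 1)).filter G.IsWeight).card :=
      Finset.card_le_card fun k hk => by
        rw [Finset.mem_filter] at hk ⊢
        exact ⟨hk.1, isWeight_of_isWeight_weight G hk.2⟩
    have h8 : ((Finset.Ioc (b - ((n + 1 : ℕ) : ℤ)) b).filter G.IsWeight).card =
        ((Finset.Ioc (b - 1 - n) (b - 1)).filter G.IsWeight).card + (if G.IsWeight b then 1 else 0) := by
      have hI : Finset.Ioc (b - ((n + 1 : ℕ) : ℤ)) b = insert b (Finset.Ioc (b - 1 - (n : ℤ)) (b - 1)) := by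
        ext k
        simp only [Finset.mem_Ioc, Finset.mem_insert]
        push_cast
        omega
      have hnot : b ∉ (Finset.Ioc (b - 1 - (n : ℤ)) (b - 1)).filter G.IsWeight := fun h => by
        have h' := (Finset.mem_filter.1 h).1
        rw [Finset.mem_Ioc] at h'
        omega
      rw [hI, Finset.filter_insert]
      split_ifs with hw
      · rw [Finset.card_insert_of_notMem hnot]
      · rw [add_zero]
    calc loewyLength G ≤ loewyLength S.quotient + loewyLength S.toMixedHodgeStructure := h1
      _ ≤ (if G.IsWeight b then 1 else 0) + ((Finset.Ioc (b - 1 - n) (b - 1)).filter G.IsWeight).card :=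
        add_le_add h2 (h6.trans h7)
      _ = ((Finset.Ioc (b - ((n + 1 : ℕ) : ℤ)) b).filter G.IsWeight).card := by rw [h8, add_comm]

open scoped Classical in
/-- The new bound refines the old one (`IsGradedPolarizable.loewyLength_le`): `#{k ∈ [a, b] | k is a weight} ≤ b - a + 1`.
[cite: Jannsen1990MixedMotives, Thm. 7.9 (proof)] -/
theorem card_filter_isWeight_le (a b : ℤ) : ((Finset.Icc a b).filter H.IsWeight).card ≤ (b - a + 1).toNat :=
  (Finset.card_filter_le _ _).trans (by rw [Int.card_Icc, show b + 1 - a = b - a + 1 by ring])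

variable [FiniteDimensional ℚ V]

open scoped Classical in
/-- **`ℓ(H) ≤ #{k ∈ [a, b] | Gr^W_k H ≠ 0}`** for a graded-polarizable `H` with `W_{a-1} H = 0`, `W_b H = H`: the
Loewy length is at most the number of weights (sharpening `IsGradedPolarizable.loewyLength_le`, `ℓ(H) ≤ b - a + 1`).
Induction on `b - a` via `ℓ(H) ≤ ℓ(H / W_{b-1} H) + ℓ(W_{b-1} H)` and `ℓ(Gr^W_b H) ≤ 1` (pure polarizable Hodge
structures are semisimple). [cite: Jannsen1990MixedMotives, Thm. 7.9 (proof)] [cite: CattaniElZeinGriffithsLe2014, p. 270] -/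
theorem IsGradedPolarizable.loewyLength_le_card_filter_isWeight (hp : H.IsGradedPolarizable) {a b : ℤ}
    (ha : H.W (a - 1) = ⊥) (hb : H.W b = ⊤) : loewyLength H ≤ ((Finset.Icc a b).filter H.IsWeight).card := by
  rcases le_or_gt (a - 1) b with hab | hab
  · obtain ⟨n, hn⟩ : ∃ n : ℕ, b - n = a - 1 :=
      ⟨(b - (a - 1)).toNat, by rw [Int.toNat_of_nonneg (by omega)]; ring⟩
    have h := loewyLength_le_card_aux n H hp b hb (by rw [hn]; exact ha)
    have hI : Finset.Ioc (b - n) b = Finset.Icc a b := by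
      ext k
      simp only [Finset.mem_Ioc, Finset.mem_Icc]
      omega
    rwa [hI] at h
  · have hbot : (⊤ : Submodule ℚ V) = ⊥ := by
      rw [← hb]
      exact eq_bot_iff.2 (by rw [← ha]; exact H.monotone_W (by omega))
    haveI : Subsingleton V := (Submodule.subsingleton_iff ℚ).1 (subsingleton_of_bot_eq_top hbot.symm)
    rw [loewyLength_eq_zero_iff.2 this]
    exact Nat.zero_le _

/-- **`ℓ(H) ≤` the number of weights of `H`** (index-free form: the set of `k` with `Gr^W_k H ≠ 0` is finite).
[cite: Jannsen1990MixedMotives, Thm. 7.9 (proof)] [cite: CattaniElZeinGriffithsLe2014, p. 270] -/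
theorem IsGradedPolarizable.loewyLength_le_ncard_isWeight (hp : H.IsGradedPolarizable) :
    loewyLength H ≤ {k | H.IsWeight k}.ncard := by
  classical
  obtain ⟨a, ha⟩ := H.exists_W_eq_bot
  obtain ⟨b, hb⟩ := H.exists_W_eq_top
  have ha' : H.W (a + 1 - 1) = ⊥ := by rw [add_sub_cancel_right]; exact ha
  refine (hp.loewyLength_le_card_filter_isWeight ha' hb).trans ?_
  rw [Set.ncard_eq_toFinset_card _ (finite_setOf_isWeight H)]
  refine Finset.card_le_card fun k hk => ?_
  rw [Set.Finite.mem_toFinset]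
  exact (Finset.mem_filter.1 hk).2

/-- At most one weight: a graded-polarizable MHS all of whose weights coincide is semisimple (`ℓ ≤ 1`).
[cite: Jannsen1990MixedMotives, Thm. 7.9 (proof)] -/
theorem IsGradedPolarizable.isSemisimple_of_isWeight_subsingleton (hp : H.IsGradedPolarizable)
    (h : ∀ k l, H.IsWeight k → H.IsWeight l → k = l) : H.IsSemisimple := by
  rw [← loewyLength_le_one_iff]
  refine hp.loewyLength_le_ncard_isWeight.trans ?_
  exact (Set.ncard_le_one (finite_setOf_isWeight H)).2 fun k hk l hl => h k l hk hl

/-- **Two weights (not necessarily adjacent): `ℓ(H) ≤ 2`** — if every weight of the graded-polarizable `H` is `m`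
or `n` then `soc² H = H`. [cite: Jannsen1990MixedMotives, Thm. 7.9 (proof)] [cite: CattaniElZeinGriffithsLe2014, p. 270] -/
theorem IsGradedPolarizable.loewyLength_le_two_of_isWeight (hp : H.IsGradedPolarizable) {m n : ℤ}
    (h : ∀ k, H.IsWeight k → k = m ∨ k = n) : loewyLength H ≤ 2 := by
  refine hp.loewyLength_le_ncard_isWeight.trans ?_
  have hsub : {k | H.IsWeight k} ⊆ ({m, n} : Set ℤ) := fun k hk => by
    rcases h k hk with rfl | rfl
    · exact Set.mem_insert _ _
    · exact Set.mem_insert_of_mem _ rfl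
  refine (Set.ncard_le_ncard hsub (Set.toFinite _)).trans ?_
  refine (Set.ncard_insert_le _ _).trans ?_
  rw [Set.ncard_singleton]

/-- In particular `soc² H = H` and `rad² H = 0` for such `H`. [cite: CattaniElZeinGriffithsLe2014, p. 270] -/
theorem IsGradedPolarizable.radicalSeries_two_eq_bot_of_isWeight (hp : H.IsGradedPolarizable) {m n : ℤ}
    (h : ∀ k, H.IsWeight k → k = m ∨ k = n) : (radicalSeries H 2).toSubmodule = ⊥ :=
  loewyLength_le_iff_radicalSeries_eq_bot.1 (hp.loewyLength_le_two_of_isWeight h)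

end Bound

end MixedHodgeStructure

end Literature.AlgebraicGeometry.Motives
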